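import Literature.NumberTheory.EllipticCurves.ModFiveCongruenceHesseFamily

/-!
# stub-ideation k2 · GENERATION 12 — `stub_switch`, crux `FreyModularity`
# PART C: Hesse's syzygy (8.1) for the direct family at `n = 5`, BOTH variables, over any field of
# characteristic `0` — input (P4) `HesseSyzygy` of PART B (`STUB_IDEAS_stub_switch_2g12_Frame.lean`).

`𝔠₄(λ,μ)³ − 𝔠₆(λ,μ)² = (c₄³ − c₆²)·𝔇(λ,μ)⁵` [Fisher2012Hessian, (8.1) with §8, n = 5].  k3-g9 proved the
case `μ = 1` (`hesse_syzygy_F`, `field_simp; ring`, ≈ 70 s); the same script proves the homogeneous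
2-variable identity (same number of monomials).  PROVED, 0 sorry (farm rc 0, wall 125 s).
-/

set_option linter.style.longLine false
set_option linter.style.setOption false
set_option linter.dupNamespace false

namespace Summit.ABC.ABC.Cruxes.FreyModularity.StubSwitchK2g12

open Literature.NumberTheory.EllipticCurves Literature.NumberTheory.EllipticCurves.HesseFamilyFive

set_option maxHeartbeats 64000000 in
/-- **Hesse's syzygy (8.1), direct family, `n = 5` (PROVED).** [Fisher2012Hessian, (8.1), §8] -/
theorem hesse_syzygy₂ {F : Type*} [Field F] [CharZero F] (c₄ c₆ l m : F) :
    C4 c₄ c₆ l m ^ 3 - C6 c₄ c₆ l m ^ 2 = (c₄ ^ 3 - c₆ ^ 2) * D c₄ c₆ l m ^ 5 := by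
  simp only [C4, C6, C4l, C4m, D, Dl, Dm, Dll, Dlm, Dmm, Dlll, Dllm, Dlmm, Dmmm]
  field_simp
  ring

/-- (P4) of PART B, literally: `HesseSyzygy` over `ℚ̄`. -/
theorem hesseSyzygy_holds :
    ∀ c₄ c₆ l m : AlgebraicClosure ℚ,
      C4 c₄ c₆ l m ^ 3 - C6 c₄ c₆ l m ^ 2 = (c₄ ^ 3 - c₆ ^ 2) * D c₄ c₆ l m ^ 5 :=
  fun c₄ c₆ l m => hesse_syzygy₂ c₄ c₆ l m

end Summit.ABC.ABC.Cruxes.FreyModularity.StubSwitchK2g12
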